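import Literature.NumberTheory.Sieve.LinearEquationsInPrimesFlatOrthogonality
import HarnessLib

/-!
# The Green–Tao–Ziegler theorem (`GreenTaoZiegler2012_finiteComplexity`): fact decomposition into
# its five external inputs

Trunk T-SIEVE (`Literature/NumberTheory/Sieve`). FACT-SPLIT file (librarian, mode `fact-decompose`,
2026-08-16) for the budget-capped XL named fact
`Literature.NumberTheory.Sieve.GreenTaoZiegler2012_finiteComplexity` (`LinearEquationsInPrimes.lean`:
the generalised Hardy–Littlewood asymptotic for systems of finite complexity; B. Green, T. Tao,
*Linear equations in primes*, Ann. of Math. 171 (2010), Main Theorem, made unconditional by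
Green–Tao 2012 (`MN(s)`) and Green–Tao–Ziegler 2012 (`GI(s)`)).

State of the tree (2026-08-16): §§4–7, §§10–12 and Apps. A–C, E of Green–Tao 2010 are theorems of
`Literature/NumberTheory/Sieve/LinearEquationsInPrimes*.lean`, and
`GreenTaoZiegler2012_finiteComplexity_of_malcev_of_GI_of_MN_of_sharp`
(`LinearEquationsInPrimesFlatOrthogonality.lean`) PROVES the fact from five inputs, each a printed
statement about nilsequences / nilmanifolds / the Goldston–Yıldırım sieve and none a rewording of the
parent; under D-0026 they could only be carried as hypotheses (predicates `Nilmanifold.IsRational`,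
`Nilmanifold.IsDivisible`, the `GI(s)` predicate of `LinearEquationsInPrimesRelativeInverse.lean`,
`GreenTao2010_MNAt`,
`GreenTao2010_sharpUniformAt`, all defined in the tree). This file names them (D-0014 named facts)
and records the PROVED assembly:

* `Malcev1951_lowerCentralSeries_rational` — **Lemma E.9 (Mal'cev)**: for every `s`-step
  nilmanifold `X = (G, Γ, d)` (tree structure `Nilmanifold s`: `G` a connected, simply connected
  Lie group, `s`-step nilpotent, `Γ` discrete cocompact) and every `j`, `Γ ∩ G_j` is cocompact in
  the lower-central-series term `G_j` (`X.IsRational`) [Green–Tao 2010, App. E, Lemma E.9;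
  Mal'cev 1949/1951; Corwin–Greenleaf Ch. 5];
* `nilmanifold_isDivisible` — **divisibility**: the Lie group `G` of every nilmanifold is divisible
  (`X.IsDivisible`: every `g` has a `q`-th root, `q ≥ 1`), since `exp : 𝔤 → G` is a diffeomorphism
  for connected simply connected nilpotent `G` [Green–Tao 2010, §12 before (12.9);
  Corwin–Greenleaf Thm. 1.2.1];
* `GreenTaoZiegler2012_inverseGowers` — **`GI(s)`** for all `s ≥ 1`, `0 < δ ≤ 1`
  (the tree's `GI(s)` predicate at `(s, δ)`: the statement `GI(s)` of Green–Tao 2010, §8 (labelled 8.3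
  there, then unproved) = Green–Tao–Ziegler 2012, Thm. 1.3 for `s ≥ 3`; `s = 2` Green–Tao 2008;
  `s = 1` classical Fourier analysis);
* `GreenTao2012_mobiusNilsequences` — **`MN(s)`** for all `s ≥ 1`, all nilmanifolds `Y` and
  Lipschitz bounds `M` (`GreenTao2010_MNAt s Y M`: the statement `MN(s)` of Green–Tao 2010, §8
  (labelled 8.5 there, then unproved) = Green–Tao, *The Möbius function is strongly orthogonal to
  nilsequences*, Ann. of Math. 175 (2012), Thm. 1.1);
* `GreenTao2010_sharpGoldstonYildirim` — **the Gowers-uniformity estimate (12.6) for the smooth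
  piece `Λ♯`** at every level `s ≥ 1`, for SOME admissible cutoff `χ` (identity on `[0, ½]`,
  Lipschitz) and SOME exponent `γ > 0` (`R = N^γ`; "an appropriate choice would be, for example,
  `γ_s := (1/10)·2^{−s}`"), proved in Green–Tao 2010, App. D from the Goldston–Yıldırım correlation
  estimate, Thm. D.3 with `a_i = 1` (`GreenTao2010_sharpUniformAt s χ (N ↦ N^γ)`);
* `GreenTaoZiegler2012_finiteComplexity_holds_of` — PROVED: the five children imply
  `GreenTaoZiegler2012_finiteComplexity` (it is
  `GreenTaoZiegler2012_finiteComplexity_of_malcev_of_GI_of_MN_of_sharp`).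

Why these five and not "Props. 10.1/10.2" (`GreenTaoZiegler2012_finiteComplexity_of_conjectures`):
with Lemma E.9 available, Cor. 11.6 and the whole of §11 and of §12 except (12.6) are already
theorems of the tree, so the finer split leaves strictly less unproved content; the two nilmanifold
facts are classical Lie theory (provable once Mathlib has the Lie correspondence / Mal'cev
coordinates), `GI(s)` and `MN(s)` are the two Annals theorems as printed, and (12.6) is a
Goldston–Yıldırım computation of the kind the tree already performs in `GreenTao2008*.lean`.

## References

* B. Green, T. Tao, *Linear equations in primes*, Ann. of Math. (2) 171 (2010), 1753–1850
  (arXiv:math/0606088): Main Theorem, §8 (Def. 8.1, the statements `GI(s)`, `MN(s)`), §12 (12.6)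
  and the paragraph before (12.9), App. D (Thm. D.3), App. E (Lemma E.9). [GreenTao2010]
* B. Green, T. Tao, T. Ziegler, *An inverse theorem for the Gowers `U^{s+1}[N]`-norm*, Ann. of
  Math. (2) 176 (2012), 1231–1372, Thm. 1.3. [GreenTaoZiegler2012]
* B. Green, T. Tao, *The Möbius function is strongly orthogonal to nilsequences*, Ann. of Math. (2)
  175 (2012), 541–566, Thm. 1.1. [GreenTao2012Mobius]
* A. I. Mal'cev, *On a class of homogeneous spaces*, Izv. Akad. Nauk SSSR 13 (1949) 9–32; AMS
  Translation 39 (1951). [Malcev1951]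
* L. J. Corwin, F. P. Greenleaf, *Representations of nilpotent Lie groups and their applications,
  Part I*, CUP (1990), Thm. 1.2.1, Ch. 5. [CorwinGreenleaf1990]
-/

noncomputable section

namespace Literature.NumberTheory.Sieve

/-- NAMED FACT — **Green–Tao 2010, Lemma E.9 (Mal'cev): the lower central series of a nilmanifold
is rational.** For every `s`-step nilmanifold `X` (`Nilmanifold s`: `G` connected, simply connected,
`s`-step nilpotent Lie group; `Γ ≤ G` discrete and cocompact) and every `j`, the subgroup `Γ ∩ G_j`
is cocompact in the lower-central-series term `G_j` — `X.IsRational` (`Nilmanifold.IsRational`,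
`LinearEquationsInPrimesHostKraNilmanifold.lean`; automatic for `j ∈ {0, 1}` and `j > s`,
`Nilmanifold.isRational_iff`). Printed: "Let `G` be a connected, simply-connected nilpotent Lie
group, and let `Γ` be a discrete cocompact subgroup. Then for any `j ≥ 1` the group `Γ ∩ G_j` is
discrete and cocompact in `G_j`." A theorem of Mal'cev (lattices of simply connected nilpotent Lie
groups meet every term of the lower central series in a lattice). Users take
`(h : Malcev1951_lowerCentralSeries_rational)`.
[cite: GreenTao2010, App. E, Lemma E.9] [cite: Malcev1951, Thm. on rational subgroups (lower central series)]
[cite: CorwinGreenleaf1990, Ch. 5 (Thm. 5.1.8, Cor. 5.2.2)] -/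
def Malcev1951_lowerCentralSeries_rational : Prop :=
  ∀ (s : ℕ) (X : Nilmanifold s), X.IsRational

/-- NAMED FACT — **the Lie group of a nilmanifold is divisible** (Green–Tao 2010, §12, before
(12.9): "any Lie group `G` over `ℝ` for which the exponential map `exp : 𝔤 → G` … is surjective is
divisible … When `G` is simply-connected and nilpotent, `exp` is a homeomorphism"). For every
`s`-step nilmanifold `X` (`Nilmanifold s`) the group `X.G` is divisible: every `g ∈ G` has a `q`-th
root for every `q ≥ 1` — `X.IsDivisible` (`Nilmanifold.IsDivisible`,
`LinearEquationsInPrimesFlatOrthogonality.lean`; immediate for `ℝ`, Heisenberg groups and products,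
proved there). Classical Lie theory: `exp` is a diffeomorphism for connected, simply connected
nilpotent Lie groups, and `exp(v/q)^q = exp(v)`. Users take `(h : nilmanifold_isDivisible)`.
[cite: GreenTao2010, §12 (paragraph before (12.9))] [cite: CorwinGreenleaf1990, Thm. 1.2.1] -/
def nilmanifold_isDivisible : Prop :=
  ∀ (s : ℕ) (X : Nilmanifold s), X.IsDivisible

/-- NAMED FACT — **the inverse theorem for the Gowers `U^{s+1}[N]`-norm, `GI(s)`, for all `s ≥ 1`**
(the statement `GI(s)` of Green–Tao 2010, §8, labelled 8.3 there and then unproved: "Suppose that `0 < δ ≤ 1`. Then there exists a finite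
collection `ℳ_{s,δ}` of `s`-step nilmanifolds … Given any `N` and any `f : [N] → [-1,1]` such that
`‖f‖_{U^{s+1}[N]} ≥ δ`, there is a nilmanifold `G/Γ ∈ ℳ_{s,δ}` and a `1`-bounded `s`-step nilsequence
`(F(gⁿx))_{n ∈ ℕ}` on it with Lipschitz constant `O_{s,δ}(1)`, such that
`|𝔼_{n ∈ [N]} f(n) F(gⁿ x)| ≫_{s,δ} 1`."), the theorem of Green–Tao–Ziegler, Ann. of Math. 176
(2012), Thm. 1.3 (`s ≥ 3`; `s = 2`: Green–Tao 2008; `s = 1`: classical). Rendered by the tree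
predicate for `GI(s)` at `(s, δ)` of `LinearEquationsInPrimesRelativeInverse.lean` (the `def` used in the
body below) at
every level `s ≥ 1` and every `0 < δ ≤ 1`; a THEOREM (Green–Tao–Ziegler 2012), cited to its proof.
Users take `(h : GreenTaoZiegler2012_inverseGowers)`.
[cite: GreenTaoZiegler2012, Thm. 1.3] [cite: GreenTao2010, §8 Def. 8.1 and the statement GI(s)] -/
def GreenTaoZiegler2012_inverseGowers : Prop :=
  ∀ s : ℕ, 1 ≤ s → ∀ δ : ℝ, 0 < δ → δ ≤ 1 → GreenTao2010_inverseConjectureAt s δ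

/-- NAMED FACT — **the Möbius function is strongly orthogonal to nilsequences, `MN(s)`, for all
`s ≥ 1`** (the statement `MN(s)` of Green–Tao 2010, §8, labelled 8.5 there and then unproved: "Let `G/Γ = (G/Γ, d_{G/Γ})` be an `s`-step
nilmanifold with smooth metric `d_{G/Γ}`, and let `(F(gⁿx))_{n ∈ [N]}` be a bounded `s`-step
nilsequence with Lipschitz constant `M`. Then we have the bound
`|𝔼_{n ≤ N} μ(n) F(gⁿ x)| ≪_{A,M,G/Γ,s} log^{-A} N` for any real number `A > 0`", the implied
constant independent of `g`, `x`), the theorem of B. Green, T. Tao, Ann. of Math. 175 (2012),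
Thm. 1.1. Rendered by the tree predicate `GreenTao2010_MNAt s Y M`
(`LinearEquationsInPrimesFlatOrthogonality.lean`) for every level `s ≥ 1`, every nilmanifold `Y` and
every Lipschitz bound `M`; a THEOREM (Green–Tao 2012), cited to its proof. Users take
`(h : GreenTao2012_mobiusNilsequences)`.
[cite: GreenTao2012Mobius, Thm. 1.1] [cite: GreenTao2010, §8 the statement MN(s)] -/
def GreenTao2012_mobiusNilsequences : Prop :=
  ∀ s : ℕ, 1 ≤ s → ∀ (Y : Nilmanifold s) (M : ℝ), GreenTao2010_MNAt s Y M

/-- NAMED FACT — **Green–Tao 2010, (12.6): the smooth piece `Λ♯` of the `W`-tricked von Mangoldt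
function is Gowers-uniform**, for every level `s ≥ 1` and SOME admissible data: a cutoff
`χ : ℝ → ℝ` with `χ(x) = x` on `[0, ½]`, Lipschitz with some constant `L_χ ≥ 0`, and an exponent
`γ > 0` (level `R = N^γ`; "an appropriate choice would be, for example, `γ_s := (1/10)·2^{−s}`")
such that `‖(φ(W)/W) Λ♯_{χ,R}(W· + b) − 1‖_{U^{s+1}[N]} = o_s(1)` uniformly in the `W`-trick range and
in `b ∈ [W]` coprime to `W` — the tree predicate `GreenTao2010_sharpUniformAt s χ (N ↦ N^γ)`
(`LinearEquationsInPrimesSplitVonMangoldt.lean`). Proved in the source in App. D ("The correlation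
estimate for `Λ♯`") from the Goldston–Yıldırım estimate Thm. D.3 with `a_i = 1`. This is the
hypothesis `hSharp` of `GreenTao2010_gowersUniformity_of_malcev_of_GI_of_MN_of_sharp`, verbatim.
Users take `(h : GreenTao2010_sharpGoldstonYildirim)`.
[cite: GreenTao2010, §12 (12.6) and App. D (Thm. D.3, a_i = 1)] -/
def GreenTao2010_sharpGoldstonYildirim : Prop :=
  ∀ s : ℕ, 1 ≤ s → ∃ (χ : ℝ → ℝ) (Lχ γ : ℝ),
    (∀ x, 0 ≤ x → x ≤ 1 / 2 → χ x = x) ∧ (∀ x y, |χ x - χ y| ≤ Lχ * |x - y|) ∧ 0 ≤ Lχ ∧ 0 < γ ∧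
      GreenTao2010_sharpUniformAt s χ fun N => (N : ℝ) ^ γ

/-- **Assembly (PROVED): the Green–Tao–Ziegler theorem from its five named inputs** — Lemma E.9,
divisibility, `GI(s)`, `MN(s)` and (12.6); all other ingredients of Green–Tao 2010 (§§4–7, §§10–12,
Apps. A–C, E) being theorems of the tree. This is
`GreenTaoZiegler2012_finiteComplexity_of_malcev_of_GI_of_MN_of_sharp`
(`LinearEquationsInPrimesFlatOrthogonality.lean`). Discharging the five children discharges
`GreenTaoZiegler2012_finiteComplexity`.
[cite: GreenTao2010, Main Theorem, Thm. 7.2, §§10–12] [cite: GreenTaoZiegler2012, Thm. 1.3]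
[cite: GreenTao2012Mobius, Thm. 1.1] -/
theorem GreenTaoZiegler2012_finiteComplexity_holds_of
    (hE9 : Malcev1951_lowerCentralSeries_rational) (hdiv : nilmanifold_isDivisible)
    (hGI : GreenTaoZiegler2012_inverseGowers) (hMN : GreenTao2012_mobiusNilsequences)
    (hSharp : GreenTao2010_sharpGoldstonYildirim) :
    GreenTaoZiegler2012_finiteComplexity :=
  GreenTaoZiegler2012_finiteComplexity_of_malcev_of_GI_of_MN_of_sharp hE9 hdiv hGI hMN hSharp

end Literature.NumberTheory.Sieve

end
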